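import Literature.RingTheory.LocalCohomology.DeligneHomomorphism
import Literature.AlgebraicGeometry.Modules.IdealMulMaps
import Literature.AlgebraicGeometry.Modules.SheafHomAffineSections
import Literature.AlgebraicGeometry.Modules.SheafHomFunctor
import Mathlib.AlgebraicGeometry.Noetherian
import HarnessLib

/-!
# The Deligne homomorphism of a section over `X ∖ V(𝓘)`, I: representing maps `𝓘(V)ⁿ → Γ(V, M)`

Hartshorne, *Algebraic Geometry*, II Ex. 5.15 / III Ex. 3.7 (a); EGA I (1971) 6.9.17 ("Deligne's
formula" `Γ(U, M) = lim→ Hom(𝓘ⁿ, M)`, `M` quasi-coherent on a Noetherian scheme, `U = X ∖ V(𝓘)`).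
Affine-local, ideal-side layer of the EXISTENCE half of that formula for affine-localizing modules
(`Modules/AffineLocalizing`), with NO torsion-freeness hypothesis on `M` (contrast
`Modules/SectionExtension`: torsion-free `M`, uniqueness of extensions) — the torsion is absorbed by
the Artin–Rees argument of `RingTheory/LocalCohomology/DeligneHomomorphism`. Setting: `W ⊆ X` open,
`𝓘 = idealOfCompl W` the radical ideal sheaf of `X ∖ W` (Mathlib `IdealSheafData.vanishingIdeal`),
`M` affine-localizing, `s ∈ Γ(W, M)`, `V` affine with `Γ(V, 𝒪_X)` Noetherian, `𝓘(V) = idealAt W hV`.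

* geometry of `𝓘`: `basicOpen_le_of_mem_idealOfCompl` (`g ∈ 𝓘(V) ⇒ D(g) ⊆ W`),
  `exists_mem_idealOfCompl_mem_basicOpen`, `inf_le_iSup_basicOpen_of_span_eq` (the `D(gₗ)` of
  generators `gₗ` of `𝓘(V)` cover `V ∩ W`) — private plumbing;
* `exists_compatible_numerators` — numerators `mₗ ∈ Γ(V, M)` of `s` on the `D(gₗ)` with the EXACT
  compatibility `gⱼᴺ mₗ = gₗᴺ mⱼ` (numerator and torsion properties of `M`);
* `Represents` (`Φ(x)|_{V ∩ W} = x · s|_{V ∩ W}`); **`exists_linearMap_represents`** — a representing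
  `Φ : 𝓘(V)ⁿ →ₗ Γ(V, M)` exists for `n ≫ 0`; **`exists_forall_eq_of_represents`** — two representing
  maps agree on `𝓘(V)ⁿ⁺ᶜ` for `c ≫ 0` (torsion + finite generation).

Sequels: `Modules/DeligneSheafHomSections`, `Modules/DeligneSheafHomGlobal`. Everything is proved;
no named facts.

## References

* R. Hartshorne, *Algebraic Geometry*, GTM 52 (1977): II Ex. 5.15, III Ex. 3.7 (a). [Hartshorne1977]
* A. Grothendieck, J. Dieudonné, EGA I (Springer 1971), 6.9.17.
-/

noncomputable section

-- `TopCat.Presheaf`/`Scheme.Modules` are not reducible (as in Mathlib's `AlgebraicGeometry/Modules`).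
set_option backward.isDefEq.respectTransparency false

open CategoryTheory AlgebraicGeometry Limits TopologicalSpace Opposite
open Literature.AlgebraicGeometry.Morphisms Literature.AlgebraicGeometry.Motives
open Literature.RingTheory.LocalCohomology

universe u

namespace Literature.AlgebraicGeometry.Modules

variable {X : Scheme.{u}}

/-! ## The ideal sheaf of `X ∖ W` and its principal opens -/

/-- The (radical) ideal sheaf `𝓘` of the closed set `X ∖ W`. [folklore] -/
abbrev idealOfCompl (W : X.Opens) : X.IdealSheafData :=
  Scheme.IdealSheafData.vanishingIdeal W.compl

section Geometry

variable (W : X.Opens)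

/-- The support of `𝓘` is `X ∖ W`. [folklore] -/
private theorem coe_support_idealOfCompl : ((idealOfCompl W).support : Set X) = (W : Set X)ᶜ :=
  Scheme.IdealSheafData.coe_support_vanishingIdeal _

/-- For `g ∈ 𝓘(V)`, `D(g) ⊆ W`. [folklore] -/
private theorem basicOpen_le_of_mem_idealOfCompl {V : X.Opens} (hV : IsAffineOpen V) {g : Γ(X, V)}
    (hg : g ∈ (idealOfCompl W).ideal ⟨V, hV⟩) : X.basicOpen g ≤ W := by
  intro x hx
  by_contra hxW
  have hmem : x ∈ ((idealOfCompl W).support : Set X) := by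
    rw [coe_support_idealOfCompl]; exact hxW
  have h3 := Scheme.IdealSheafData.mem_support_iff.mp hmem ⟨V, hV⟩
  rw [Scheme.mem_zeroLocus_iff] at h3
  exact h3 g hg hx

/-- A point of `V ∩ W` lies in some `D(g)`, `g ∈ 𝓘(V)`. [folklore] -/
private theorem exists_mem_idealOfCompl_mem_basicOpen {V : X.Opens} (hV : IsAffineOpen V) {x : X}
    (hxV : x ∈ V) (hxW : x ∈ W) : ∃ g ∈ (idealOfCompl W).ideal ⟨V, hV⟩, x ∈ X.basicOpen g := by
  by_contra hno
  push Not at hno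
  have hx : x ∈ (idealOfCompl W).support := by
    rw [Scheme.IdealSheafData.mem_support_iff_of_mem (U := ⟨V, hV⟩) hxV, Scheme.mem_zeroLocus_iff]
    exact hno
  have hx' : x ∈ ((idealOfCompl W).support : Set X) := hx
  rw [coe_support_idealOfCompl] at hx'
  exact hx' hxW

/-- `V ∩ W` is covered by the `D(gₗ)` for any family `gₗ` generating `𝓘(V)`. [folklore] -/
private theorem inf_le_iSup_basicOpen_of_span_eq {V : X.Opens} (hV : IsAffineOpen V) {κ : Type*}
    (g : κ → Γ(X, V)) (hg : Ideal.span (Set.range g) = (idealOfCompl W).ideal ⟨V, hV⟩) :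
    V ⊓ W ≤ ⨆ l, X.basicOpen (g l) := by
  intro x hx
  obtain ⟨a, ha, hxa⟩ := exists_mem_idealOfCompl_mem_basicOpen W hV hx.1 hx.2
  rw [← hg] at ha
  by_contra hno
  have hno' : ∀ l, x ∉ X.basicOpen (g l) := fun l hl => hno (Opens.mem_iSup.mpr ⟨l, hl⟩)
  -- `x` lies in the zero locus of every `g l`, hence of `a ∈ span (g l)`
  have hxz : x ∈ X.zeroLocus (U := V) (Set.range g) := by
    rw [Scheme.mem_zeroLocus_iff]
    rintro _ ⟨l, rfl⟩
    exact hno' l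
  rw [← Scheme.zeroLocus_span] at hxz
  exact (Scheme.mem_zeroLocus_iff _ _ _).mp hxz a ha hxa

end Geometry

/-! ## Transport helpers -/

section Transport

variable (M : X.Modules)

/-- Restricting twice is restricting once (sections of `M`). [folklore] -/
private theorem mmap_mmap {A B C : X.Opens} (h1 : B ≤ A) (h2 : C ≤ B) (m : Γ(M, A)) :
    M.presheaf.map (homOfLE h2).op (M.presheaf.map (homOfLE h1).op m) =
      M.presheaf.map (homOfLE (h2.trans h1)).op m := by
  rw [map_map]
  exact map_eq_map M _ _ m

omit M in
/-- Restricting twice is restricting once (functions). [folklore] -/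
private theorem xmap_xmap {A B C : X.Opens} (h1 : B ≤ A) (h2 : C ≤ B) (r : Γ(X, A)) :
    X.presheaf.map (homOfLE h2).op (X.presheaf.map (homOfLE h1).op r) =
      X.presheaf.map (homOfLE (h2.trans h1)).op r := by
  rw [← CategoryTheory.comp_apply, ← Functor.map_comp]
  rfl

end Transport

/-! ## Compatible numerators of a section over `W` on the principal opens `D(gₗ) ⊆ W` -/

section Numerators

variable {M : X.Modules} (hM : IsAffineLocalizing M) {W V : X.Opens} (hV : IsAffineOpen V)
  (s : Γ(M, W)) {κ : Type*} [Fintype κ] (g : κ → Γ(X, V)) (hgW : ∀ l, X.basicOpen (g l) ≤ W)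

include hM hV in
/-- **Compatible numerators**: there are `N` and `mₗ ∈ Γ(V, M)` with `mₗ|_{D(gₗ)} = gₗᴺ · s|_{D(gₗ)}`
and `gⱼᴺ · mₗ = gₗᴺ · mⱼ` in `Γ(V, M)` (numerators of `s` on each `D(gₗ)`, made exactly compatible by
the torsion property on `D(gₗgⱼ)`). [cite: Hartshorne1977, III Ex. 3.7 (a)] -/
theorem exists_compatible_numerators :
    ∃ (N : ℕ) (m : κ → Γ(M, V)),
      (∀ l, M.presheaf.map (homOfLE (X.basicOpen_le (g l))).op (m l) =
        X.presheaf.map (homOfLE (X.basicOpen_le (g l))).op (g l) ^ N •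
          M.presheaf.map (homOfLE (hgW l)).op s) ∧
      ∀ l j, g j ^ N • m l = g l ^ N • m j := by
  classical
  -- numerators with individual exponents
  have hnum : ∀ l, ∃ (n : ℕ) (x : Γ(M, V)),
      M.presheaf.map (homOfLE (X.basicOpen_le (g l))).op x =
        X.presheaf.map (homOfLE (X.basicOpen_le (g l))).op (g l) ^ n •
          M.presheaf.map (homOfLE (hgW l)).op s :=
    fun l => hM.numerator hV (g l) rfl (M.presheaf.map (homOfLE (hgW l)).op s)
  choose n x hx using hnum
  -- unify the exponents
  let N₀ : ℕ := Finset.univ.sup n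
  have hnN : ∀ l, n l ≤ N₀ := fun l => Finset.le_sup (Finset.mem_univ l)
  obtain ⟨x', hx'⟩ : ∃ x' : κ → Γ(M, V), ∀ l,
      M.presheaf.map (homOfLE (X.basicOpen_le (g l))).op (x' l) =
        X.presheaf.map (homOfLE (X.basicOpen_le (g l))).op (g l) ^ N₀ •
          M.presheaf.map (homOfLE (hgW l)).op s := by
    refine ⟨fun l => g l ^ (N₀ - n l) • x l, fun l => ?_⟩
    simp only [Scheme.Modules.map_smul, hx l, map_pow, ← mul_smul, ← pow_add,
      Nat.sub_add_cancel (hnN l)]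
  -- restriction of `x' l'` to `D(gₗ gⱼ) ⊆ D(g l')`
  have hres : ∀ (l j l' : κ) (h1 : X.basicOpen (g l * g j) ≤ X.basicOpen (g l')),
      M.presheaf.map (homOfLE (X.basicOpen_le (g l * g j))).op (x' l') =
        X.presheaf.map (homOfLE (X.basicOpen_le (g l * g j))).op (g l') ^ N₀ •
          M.presheaf.map (homOfLE ((h1.trans (hgW l')))).op s := by
    intro l j l' h1
    rw [← mmap_mmap M (X.basicOpen_le (g l')) h1, hx' l', Scheme.Modules.map_smul, map_pow,
      xmap_xmap, mmap_mmap]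
  -- the differences `gⱼ^N₀ x'ₗ - gₗ^N₀ x'ⱼ` vanish on `D(gₗ gⱼ)`, hence are killed by `(gₗ gⱼ)^K`
  have hdiff : ∀ l j, ∃ K : ℕ, (g l * g j) ^ K • (g j ^ N₀ • x' l - g l ^ N₀ • x' j) = 0 := by
    intro l j
    have hle : X.basicOpen (g l * g j) ≤ V := X.basicOpen_le _
    have hDl : X.basicOpen (g l * g j) ≤ X.basicOpen (g l) := by
      rw [Scheme.basicOpen_mul]; exact inf_le_left
    have hDj : X.basicOpen (g l * g j) ≤ X.basicOpen (g j) := by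
      rw [Scheme.basicOpen_mul]; exact inf_le_right
    refine hM.torsion hV (g l * g j) _ (W := X.basicOpen (g l * g j)) hle le_rfl ?_
    rw [map_sub, Scheme.Modules.map_smul, Scheme.Modules.map_smul, hres l j l hDl, hres l j j hDj,
      map_pow, map_pow, smul_smul, smul_smul, sub_eq_zero]
    congr 1
    exact mul_comm _ _
  choose K hK using hdiff
  let K₀ : ℕ := Finset.univ.sup fun p : κ × κ => K p.1 p.2
  have hKK : ∀ l j, K l j ≤ K₀ := fun l j =>
    Finset.le_sup (f := fun p : κ × κ => K p.1 p.2) (Finset.mem_univ (l, j))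
  have h0 : ∀ l j, (g l * g j) ^ K₀ • (g j ^ N₀ • x' l - g l ^ N₀ • x' j) = 0 := by
    intro l j
    obtain ⟨d, hd⟩ := Nat.exists_eq_add_of_le (hKK l j)
    rw [hd, pow_add, mul_comm, mul_smul, hK l j, smul_zero]
  refine ⟨N₀ + K₀, fun l => g l ^ K₀ • x' l, fun l => ?_, fun l j => ?_⟩
  · rw [Scheme.Modules.map_smul, hx' l, map_pow, ← mul_smul, ← pow_add, add_comm]
  · dsimp only
    rw [← mul_smul, ← mul_smul,
      show g j ^ (N₀ + K₀) * g l ^ K₀ = (g l * g j) ^ K₀ * g j ^ N₀ by ring,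
      show g l ^ (N₀ + K₀) * g j ^ K₀ = (g l * g j) ^ K₀ * g l ^ N₀ by ring,
      mul_smul, mul_smul, ← sub_eq_zero, ← smul_sub, h0]

end Numerators

/-! ## Representing linear maps `𝓘(V)ⁿ → Γ(V, M)` -/

section Represents

variable {M : X.Modules} (W : X.Opens) (s : Γ(M, W)) {V : X.Opens} (hV : IsAffineOpen V)

/-- The ideal `𝓘(V) ⊆ Γ(V, 𝒪_X)` of `X ∖ W`. [folklore] -/
abbrev idealAt : Ideal Γ(X, V) := (idealOfCompl W).ideal ⟨V, hV⟩

/-- **`Φ : 𝓘(V)ⁿ → Γ(V, M)` represents `s`**: `Φ(x)|_{V ∩ W} = x|_{V ∩ W} · s|_{V ∩ W}` for all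
`x ∈ 𝓘(V)ⁿ`. [cite: Hartshorne1977, III Ex. 3.7 (a)] -/
def Represents (n : ℕ) (Φ : ↥(idealAt W hV ^ n) →ₗ[Γ(X, V)] Γ(M, V)) : Prop :=
  ∀ x : ↥(idealAt W hV ^ n),
    M.presheaf.map (homOfLE (inf_le_left : V ⊓ W ≤ V)).op (Φ x) =
      X.presheaf.map (homOfLE (inf_le_left : V ⊓ W ≤ V)).op (x : Γ(X, V)) •
        M.presheaf.map (homOfLE (inf_le_right : V ⊓ W ≤ W)).op s

variable {W s hV}

/-- Generators of `𝓘(V)` lie in `𝓘(V)`. [folklore] -/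
private theorem mem_idealAt_of_span_eq {κ : Type*} {g : κ → Γ(X, V)}
    (hg : Ideal.span (Set.range g) = idealAt W hV) (l : κ) : g l ∈ idealAt W hV := by
  have h : g l ∈ Ideal.span (Set.range g) := Ideal.subset_span ⟨l, rfl⟩
  rwa [hg] at h

/-- Two sections of `M` over `V ∩ W` agreeing on every `D(gₗ)`, for a family `gₗ` generating
`𝓘(V)` (so that the `D(gₗ)` cover `V ∩ W`), are equal. [folklore] -/
private theorem eq_of_forall_map_basicOpen_eq {κ : Type*} (g : κ → Γ(X, V))
    (hg : Ideal.span (Set.range g) = idealAt W hV) {t t' : Γ(M, V ⊓ W)}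
    (h : ∀ l (hl : X.basicOpen (g l) ≤ V ⊓ W),
      M.presheaf.map (homOfLE hl).op t = M.presheaf.map (homOfLE hl).op t') : t = t' := by
  have hgW : ∀ l, X.basicOpen (g l) ≤ W := fun l =>
    basicOpen_le_of_mem_idealOfCompl W hV (mem_idealAt_of_span_eq hg l)
  have hl : ∀ l, X.basicOpen (g l) ≤ V ⊓ W := fun l => le_inf (X.basicOpen_le _) (hgW l)
  exact TopCat.Sheaf.eq_of_locally_eq' (abSheafOf M) (fun l => X.basicOpen (g l)) (V ⊓ W)
    (fun l => homOfLE (hl l)) (inf_le_iSup_basicOpen_of_span_eq W hV g hg) t t' fun l => h l (hl l)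

variable (W s hV) in
/-- **Existence of a representing map** (the Deligne homomorphism): for `M` affine-localizing and
`Γ(V, 𝒪_X)` Noetherian there are `n` and `Φ : 𝓘(V)ⁿ →ₗ Γ(V, M)` representing `s`.
[cite: Hartshorne1977, III Ex. 3.7 (a)] -/
theorem exists_linearMap_represents (hM : IsAffineLocalizing M) [IsNoetherianRing Γ(X, V)] :
    ∃ (n : ℕ) (Φ : ↥(idealAt W hV ^ n) →ₗ[Γ(X, V)] Γ(M, V)), Represents W s hV n Φ := by
  classical
  -- generators of `𝓘(V)`
  obtain ⟨r, g, hg⟩ := Submodule.fg_iff_exists_fin_generating_family.mp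
    (IsNoetherian.noetherian (idealAt W hV))
  have hgW : ∀ l, X.basicOpen (g l) ≤ W := fun l =>
    basicOpen_le_of_mem_idealOfCompl W hV (mem_idealAt_of_span_eq hg l)
  obtain ⟨N, m, hm, hcomp⟩ := exists_compatible_numerators hM hV s g hgW
  -- the ring-level Deligne homomorphism for `hₗ = gₗ^N`
  have hrad : idealAt W hV ≤ (Ideal.span (Set.range fun l => g l ^ N)).radical := by
    rw [← hg]
    refine Ideal.span_le.mpr ?_
    rintro _ ⟨l, rfl⟩
    exact ⟨N, Ideal.subset_span ⟨l, rfl⟩⟩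
  obtain ⟨n, Φ, hΦ⟩ := exists_linearMap_pow_smul_eq_of_le_radical (fun l => g l ^ N) m
    (fun i j => hcomp i j) hrad
  refine ⟨n, Φ, fun x => ?_⟩
  -- check the identity on each `D(gₗ)`, where `gₗ^N` is a unit
  refine eq_of_forall_map_basicOpen_eq g hg fun l hl => ?_
  have hlV : X.basicOpen (g l) ≤ V := X.basicOpen_le _
  apply pow_smul_injective M (g l) (le_refl (X.basicOpen (g l))) N
  dsimp only
  rw [mmap_mmap, Scheme.Modules.map_smul, mmap_mmap, xmap_xmap, ← map_pow,
    ← Scheme.Modules.map_smul, hΦ x l, Scheme.Modules.map_smul, hm l, map_pow, smul_smul, smul_smul,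
    mul_comm]

/-- **Agreement of representing maps**: two maps representing `s` on `𝓘(V)ⁿ` agree on `𝓘(V)ⁿ⁺ᶜ` for
some `c` (their difference takes values vanishing on `V ∩ W`, hence killed by a power of `𝓘(V)`
by the torsion property and finite generation). [cite: Hartshorne1977, III Ex. 3.7 (a)] -/
theorem exists_forall_eq_of_represents (hM : IsAffineLocalizing M) [IsNoetherianRing Γ(X, V)]
    {n : ℕ} {Φ Φ' : ↥(idealAt W hV ^ n) →ₗ[Γ(X, V)] Γ(M, V)} (hΦ : Represents W s hV n Φ)
    (hΦ' : Represents W s hV n Φ') :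
    ∃ c : ℕ, ∀ (x : Γ(X, V)) (hx : x ∈ idealAt W hV ^ (n + c)),
      Φ ⟨x, Ideal.pow_le_pow_right (Nat.le_add_right n c) hx⟩ =
        Φ' ⟨x, Ideal.pow_le_pow_right (Nat.le_add_right n c) hx⟩ := by
  classical
  set δ : ↥(idealAt W hV ^ n) →ₗ[Γ(X, V)] Γ(M, V) := Φ - Φ' with hδ
  -- `δ y` vanishes on `V ∩ W`
  have hδ0 : ∀ y, M.presheaf.map (homOfLE (inf_le_left : V ⊓ W ≤ V)).op (δ y) = 0 := by
    intro y
    rw [hδ, LinearMap.sub_apply, map_sub, hΦ y, hΦ' y, sub_self]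
  -- generators `gₗ` of `𝓘(V)` and `yⱼ` of `𝓘(V)ⁿ`
  obtain ⟨r, g, hg⟩ := Submodule.fg_iff_exists_fin_generating_family.mp
    (IsNoetherian.noetherian (idealAt W hV))
  have hgW : ∀ l, X.basicOpen (g l) ≤ W := fun l =>
    basicOpen_le_of_mem_idealOfCompl W hV (mem_idealAt_of_span_eq hg l)
  obtain ⟨r', y, hy⟩ := Submodule.fg_iff_exists_fin_generating_family.mp
    (IsNoetherian.noetherian (idealAt W hV ^ n))
  have hyI : ∀ j, y j ∈ idealAt W hV ^ n := fun j => by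
    have h : y j ∈ Submodule.span Γ(X, V) (Set.range y) := Submodule.subset_span ⟨j, rfl⟩
    rwa [hy] at h
  -- each `δ yⱼ` is killed by a power of each `gₗ`
  have hkill : ∀ l j, ∃ k : ℕ, g l ^ k • δ ⟨y j, hyI j⟩ = 0 := by
    intro l j
    have hl : X.basicOpen (g l) ≤ V ⊓ W := le_inf (X.basicOpen_le _) (hgW l)
    refine hM.torsion hV (g l) _ (W := X.basicOpen (g l)) (X.basicOpen_le _) le_rfl ?_
    rw [← mmap_mmap M (inf_le_left : V ⊓ W ≤ V) hl, hδ0, map_zero]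
  choose k hk using hkill
  let k₀ : ℕ := Finset.univ.sup fun p : Fin r × Fin r' => k p.1 p.2
  have hkk : ∀ l j, k l j ≤ k₀ := fun l j =>
    Finset.le_sup (f := fun p : Fin r × Fin r' => k p.1 p.2) (Finset.mem_univ (l, j))
  -- hence `gₗ^k₀` kills every `δ z`: the `z` with this property form a submodule containing the `yⱼ`
  have hkill' : ∀ (l) (z : ↥(idealAt W hV ^ n)), g l ^ k₀ • δ z = 0 := by
    intro l
    let S : Submodule Γ(X, V) ↥(idealAt W hV ^ n) :=
      { carrier := {z | g l ^ k₀ • δ z = 0}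
        zero_mem' := by simp
        add_mem' := fun {a b} ha hb => by
          simp only [Set.mem_setOf_eq, map_add, smul_add] at ha hb ⊢
          rw [ha, hb, add_zero]
        smul_mem' := fun t a ha => by
          simp only [Set.mem_setOf_eq, map_smul] at ha ⊢
          rw [smul_comm, ha, smul_zero] }
    have hgen : ∀ j, (⟨y j, hyI j⟩ : ↥(idealAt W hV ^ n)) ∈ S := by
      intro j
      obtain ⟨d, hd⟩ := Nat.exists_eq_add_of_le (hkk l j)
      change g l ^ k₀ • δ ⟨y j, hyI j⟩ = 0
      rw [hd, pow_add, mul_comm, mul_smul, hk l j, smul_zero]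
    -- the `yⱼ` generate `𝓘(V)ⁿ`, i.e. their lifts generate the subtype module
    have htop : ∀ z : ↥(idealAt W hV ^ n), z ∈ S := by
      intro z
      obtain ⟨z, hz⟩ := z
      have hz' : z ∈ Submodule.span Γ(X, V) (Set.range y) := by rw [hy]; exact hz
      induction hz' using Submodule.span_induction with
      | mem w hw =>
        obtain ⟨j, rfl⟩ := hw
        exact hgen j
      | zero => exact S.zero_mem
      | add a b ha hb iha ihb =>
        have ha' : a ∈ idealAt W hV ^ n := by rw [← hy]; exact ha
        have hb' : b ∈ idealAt W hV ^ n := by rw [← hy]; exact hb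
        have : (⟨a + b, hz⟩ : ↥(idealAt W hV ^ n)) = ⟨a, ha'⟩ + ⟨b, hb'⟩ := rfl
        rw [this]
        exact S.add_mem (iha ha') (ihb hb')
      | smul t a ha iha =>
        have ha' : a ∈ idealAt W hV ^ n := by rw [← hy]; exact ha
        have : (⟨t • a, hz⟩ : ↥(idealAt W hV ^ n)) = t • ⟨a, ha'⟩ := rfl
        rw [this]
        exact S.smul_mem t (iha ha')
    exact fun z => htop z
  -- `J' = (gₗ^k₀)` kills every `δ z`, and `𝓘(V)^c ≤ J'` for some `c`
  set J' : Ideal Γ(X, V) := Ideal.span (Set.range fun l => g l ^ k₀) with hJ'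
  have hJ'kill : ∀ (a : Γ(X, V)) (_ : a ∈ J') (z : ↥(idealAt W hV ^ n)), a • δ z = 0 := by
    intro a ha z
    rw [← Submodule.mem_annihilator_span_singleton]
    have hle : J' ≤ (Submodule.span Γ(X, V) {δ z}).annihilator := by
      refine Ideal.span_le.mpr ?_
      rintro _ ⟨l, rfl⟩
      exact (Submodule.mem_annihilator_span_singleton _ _).mpr (hkill' l z)
    exact hle ha
  have hrad : idealAt W hV ≤ J'.radical := by
    rw [← hg]
    refine Ideal.span_le.mpr ?_
    rintro _ ⟨l, rfl⟩
    exact ⟨k₀, Ideal.subset_span ⟨l, rfl⟩⟩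
  obtain ⟨c, hc⟩ := Ideal.exists_pow_le_of_le_radical_of_fg hrad (IsNoetherian.noetherian _)
  refine ⟨c, fun x hx => ?_⟩
  rw [← sub_eq_zero, ← LinearMap.sub_apply, ← hδ]
  -- `x ∈ 𝓘^(n+c) = 𝓘^c * 𝓘^n ≤ J' * 𝓘^n`
  have hx' : x ∈ J' * idealAt W hV ^ n := by
    rw [pow_add, mul_comm] at hx
    exact Ideal.mul_mono_left hc hx
  -- induction over the product ideal, the membership proof being part of the predicate
  suffices h : ∃ hx'' : x ∈ idealAt W hV ^ n, δ ⟨x, hx''⟩ = 0 by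
    obtain ⟨hx'', h⟩ := h; exact h
  refine Submodule.smul_induction_on (p := fun x => ∃ hx'' : x ∈ idealAt W hV ^ n, δ ⟨x, hx''⟩ = 0)
    hx' ?_ ?_
  · intro a ha b hb
    refine ⟨Ideal.mul_mem_left _ a hb, ?_⟩
    have : (⟨a • b, Ideal.mul_mem_left _ a hb⟩ : ↥(idealAt W hV ^ n)) = a • ⟨b, hb⟩ := rfl
    rw [this, map_smul]
    exact hJ'kill a ha _
  · rintro a b ⟨ha, ha0⟩ ⟨hb, hb0⟩
    refine ⟨Ideal.add_mem _ ha hb, ?_⟩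
    have : (⟨a + b, Ideal.add_mem _ ha hb⟩ : ↥(idealAt W hV ^ n)) = ⟨a, ha⟩ + ⟨b, hb⟩ := rfl
    rw [this, map_add, ha0, hb0, add_zero]

end Represents

end Literature.AlgebraicGeometry.Modules

end
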